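import Summits.SmoothPoincare4.SmoothPoincare4.Theses.EntropyRung
import Summits.SmoothPoincare4.SmoothPoincare4.Theorems.EntropyRungSubcylindricalExistenceSphereSideClauseAux
import Summits.SmoothPoincare4.SmoothPoincare4.Theorems.EntropyRungSubcylindricalExistenceCapRealisation
import HarnessLib

/-!
# The exact-cone weight on `M` (aux helper `helper_annulusModelOnM_weight` of stub
`helper_annulusModelOnM`, H-annM, line `fat-conical-core-avr-logsobolev`, crux
`EntropyRung.SubcylindricalExistence`, item stmt-SmoothPoincare4-10871)

For a point `p` of a `4`-manifold `M` of the summit binder with chart `φ = extChartAt (𝓡 4) p`,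
`y₀ = φ p`, a radius `r > 0` with `closedBall y₀ r ⊆ φ.target`, a slope `c' > 0`, a constant
`μ > 0` and radii `0 < ρ₁ < ρ₂ < r`, we construct a smooth positive `ψ₀ : M → ℝ` with
`ψ₀ x = μ c' ‖φ x − y₀‖^{−(c'+1)}` on the closed chart annulus `ρ₁ ≤ ‖φ x − y₀‖ ≤ ρ₂`.

Construction. A smooth positive profile `n : ℝ → ℝ` with `n(t) = t^{−(c'+1)/2}` on `[ρ₁², ρ₂²]`
and `n ≡ 1` on `[S, ∞)` for some `0 < S < r²`: the blend `χ t^{−(c'+1)/2} + (1 − χ)` with a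
one-dimensional bump `χ` equal to `1` on `[ρ₁², ρ₂²]` and supported in `(ρ₁² − δ, ρ₂² + δ)`,
`0 < δ < min(ρ₁², r² − ρ₂²)` (the power is smooth off `t = 0`, where `χ` vanishes identically
nearby). Then `ψ₀ x = μ c' n(‖φ x − y₀‖²)` on the open chart ball and `ψ₀ = μ c'` off it; this is
smooth by the two-open-sets argument of `HelperCapRealisationAux.contMDiff_cap`: on the open chart
ball it is a smooth Euclidean function of `φ x`, and on the open complement of the compact core
`φ⁻¹(closedBall y₀ r ∩ {‖· − y₀‖² ≤ S})` it is constant. We also record the weight algebra of the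
dilation `s ↦ s/μ²` used by the companion file. References: Lee–Parker 1987, §3 (conformally
flat coordinates); Perelman 2002, §3 (scaling of the `𝒲`-functional). [folklore]
-/

noncomputable section

-- the registered namespace `Summit.SmoothPoincare4.SmoothPoincare4.Theorems` repeats a component
set_option linter.dupNamespace false

open scoped Manifold ContDiff Topology RealInnerProductSpace
open Set Filter MeasureTheory
open Literature.Geometry.Lorentzian Literature.Geometry.Riemannian

namespace Summit.SmoothPoincare4.SmoothPoincare4.Theorems

namespace AnnulusModelOnM

open SphereSideClause

/-! ### The weight algebra of the dilation `s ↦ s/μ²` -/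

/-- The weight algebra of the normalisation: `(4π s/μ²)^{-2} L⁴ = (4πs)^{-2} (μL)⁴`. [folklore] -/
theorem weight_identity₀ {μ s : ℝ} (hμ : 0 < μ) (hs : 0 < s) (L : ℝ) :
    (4 * Real.pi * (s / μ ^ 2)) ^ (-(4 : ℝ) / 2) * L ^ 4 =
      (4 * Real.pi * s) ^ (-(4 : ℝ) / 2) * (μ * L) ^ 4 := by
  rw [rpow_neg_four_half (by positivity), rpow_neg_four_half (by positivity)]
  have hpi := Real.pi_pos
  field_simp

/-- The weight algebra of the dilation, full integrand: the Euclidean annulus-floor integrand for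
the weight `L` at scale `s/μ²` is the `μL`-weighted integrand at scale `s`. [folklore] -/
theorem weight_identity {μ s : ℝ} (hμ : 0 < μ) (hs : 0 < s) (L V2 Gn Lg : ℝ) :
    (4 * (s / μ ^ 2) * (L⁻¹ ^ 2 * Gn) - Lg - 4 * V2) *
        ((4 * Real.pi * (s / μ ^ 2)) ^ (-(4 : ℝ) / 2) * L ^ 4) =
      (s * (4 * ((μ * L)⁻¹ ^ 2 * Gn)) - Lg - 4 * V2) *
        ((4 * Real.pi * s) ^ (-(4 : ℝ) / 2) * (μ * L) ^ 4) := by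
  rw [weight_identity₀ hμ hs L, mul_inv, mul_pow]
  congr 1
  rw [inv_pow, div_eq_mul_inv]
  ring

/-! ### The one-dimensional profile -/

/-- A smooth positive profile `n` on `ℝ` with `n(t) = t^{−(c'+1)/2}` on `[ρ₁², ρ₂²]` and `n ≡ 1`
on `[S, ∞)` for some `0 < S < r²` (bump-function blend of the power with the constant `1`).
[folklore] -/
theorem exists_profile {c' ρ₁ ρ₂ r : ℝ} (hρ₁ : 0 < ρ₁) (hρ₁₂ : ρ₁ < ρ₂) (hρ₂r : ρ₂ < r) :
    ∃ n : ℝ → ℝ, ∃ S : ℝ, ContDiff ℝ ∞ n ∧ (∀ t, 0 < n t) ∧ 0 < S ∧ S < r ^ 2 ∧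
      (∀ t, ρ₁ ^ 2 ≤ t → t ≤ ρ₂ ^ 2 → n t = t ^ (-(c' + 1) / 2)) ∧
      (∀ t, S ≤ t → n t = 1) := by
  have hρ₂ : 0 < ρ₂ := hρ₁.trans hρ₁₂
  have h12 : ρ₁ ^ 2 < ρ₂ ^ 2 := pow_lt_pow_left₀ hρ₁₂ hρ₁.le two_ne_zero
  have h2r : ρ₂ ^ 2 < r ^ 2 := pow_lt_pow_left₀ hρ₂r hρ₂.le two_ne_zero
  have hρ₁2 : 0 < ρ₁ ^ 2 := by positivity
  obtain ⟨δ, hδ, hδ₁, hδ₂⟩ : ∃ δ : ℝ, 0 < δ ∧ δ < ρ₁ ^ 2 ∧ δ < r ^ 2 - ρ₂ ^ 2 :=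
    ⟨min (ρ₁ ^ 2 / 2) ((r ^ 2 - ρ₂ ^ 2) / 2), lt_min (by positivity) (by linarith),
      (min_le_left _ _).trans_lt (by linarith), (min_le_right _ _).trans_lt (by linarith)⟩
  obtain ⟨χ, hrIn, hrOut⟩ : ∃ χ : ContDiffBump ((ρ₁ ^ 2 + ρ₂ ^ 2) / 2),
      χ.rIn = (ρ₂ ^ 2 - ρ₁ ^ 2) / 2 ∧ χ.rOut = (ρ₂ ^ 2 - ρ₁ ^ 2) / 2 + δ :=
    ⟨⟨_, _, by linarith, by linarith⟩, rfl, rfl⟩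
  have hχ0 : ∀ t, t ≤ ρ₁ ^ 2 - δ → χ t = 0 := fun t ht ↦
    χ.zero_of_le_dist (by rw [hrOut, Real.dist_eq, abs_sub_comm, abs_of_pos (by linarith)]; linarith)
  have hχ1 : ∀ t, ρ₂ ^ 2 + δ ≤ t → χ t = 0 := fun t ht ↦
    χ.zero_of_le_dist (by rw [hrOut, Real.dist_eq, abs_of_pos (by linarith)]; linarith)
  refine ⟨fun t ↦ χ t * t ^ (-(c' + 1) / 2) + (1 - χ t), ρ₂ ^ 2 + δ, ?_, ?_, by positivity,
    by linarith, ?_, ?_⟩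
  · refine ContDiff.add ?_ (contDiff_const.sub χ.contDiff)
    rw [contDiff_iff_contDiffAt]
    intro t
    by_cases ht : t = 0
    · subst ht
      have hev : (χ : ℝ → ℝ) =ᶠ[𝓝 0] 0 := by
        rw [← notMem_tsupport_iff_eventuallyEq, χ.tsupport_eq, Metric.mem_closedBall, Real.dist_eq,
          hrOut, zero_sub, abs_neg, abs_of_pos (by positivity)]
        linarith
      refine (contDiffAt_const (c := (0 : ℝ))).congr_of_eventuallyEq ?_
      filter_upwards [hev] with u hu
      simp [hu]
    · exact χ.contDiff.contDiffAt.mul (Real.contDiffAt_rpow_const_of_ne ht)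
  · intro t
    show 0 < χ t * t ^ (-(c' + 1) / 2) + (1 - χ t)
    have h0 : 0 ≤ χ t := χ.nonneg
    have h1 : χ t ≤ 1 := χ.le_one
    by_cases ht : 0 < t
    · have hp : 0 < t ^ (-(c' + 1) / 2) := Real.rpow_pos_of_pos ht _
      rcases h1.lt_or_eq with h1 | h1
      · exact add_pos_of_nonneg_of_pos (mul_nonneg h0 hp.le) (by linarith)
      · rw [h1]; simpa using hp
    · rw [hχ0 t (by linarith)]
      simp
  · intro t ht1 ht2
    have : χ t = 1 := χ.one_of_mem_closedBall (by
      rw [Metric.mem_closedBall, Real.dist_eq, hrIn, abs_le]; constructor <;> linarith)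
    simp [this]
  · intro t ht
    simp [hχ1 t ht]

/-! ### The weight on `M` -/

/-- **The exact-cone weight on `M`**: a smooth positive `ψ₀ : M → ℝ` equal to
`μ c' ‖φ x − φ p‖^{−(c'+1)}` on the closed chart annulus `ρ₁ ≤ ‖φ x − φ p‖ ≤ ρ₂`
(`ρ₂ < r`, `closedBall (φ p) r ⊆ φ.target`): `μ c' n(‖φ x − φ p‖²)` on the open chart ball,
the constant `μ c'` off it; smooth by the two-open-sets argument. [folklore] -/
theorem exists_weight {M : Type*} [TopologicalSpace M] [T2Space M]
    [ChartedSpace (EuclideanSpace ℝ (Fin 4)) M] [IsManifold (𝓡 4) ∞ M] {p : M}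
    {r c' μ ρ₁ ρ₂ : ℝ}
    (hball : Metric.closedBall (extChartAt (𝓡 4) p p) r ⊆ (extChartAt (𝓡 4) p).target)
    (hr : 0 < r) (hc' : 0 < c') (hμ : 0 < μ) (hρ₁ : 0 < ρ₁) (hρ₁₂ : ρ₁ < ρ₂) (hρ₂r : ρ₂ < r) :
    ∃ ψ₀ : M → ℝ, ContMDiff (𝓡 4) 𝓘(ℝ, ℝ) ∞ ψ₀ ∧ (∀ x, 0 < ψ₀ x) ∧
      ∀ x, x ∈ (extChartAt (𝓡 4) p).source →
        ρ₁ ≤ ‖extChartAt (𝓡 4) p x - extChartAt (𝓡 4) p p‖ →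
        ‖extChartAt (𝓡 4) p x - extChartAt (𝓡 4) p p‖ ≤ ρ₂ →
          ψ₀ x = μ * (c' * ‖extChartAt (𝓡 4) p x - extChartAt (𝓡 4) p p‖ ^ (-(c' + 1))) := by
  classical
  obtain ⟨n, S, hn, hnpos, _, hSr, hnann, hn1⟩ := exists_profile (c' := c') hρ₁ hρ₁₂ hρ₂r
  set prof : ℝ → ℝ := fun t ↦ μ * (c' * n t) with hprof
  set ψ₀ : M → ℝ := fun x ↦ if x ∈ (extChartAt (𝓡 4) p).source ∧
      ‖extChartAt (𝓡 4) p x - extChartAt (𝓡 4) p p‖ < r then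
      prof (‖extChartAt (𝓡 4) p x - extChartAt (𝓡 4) p p‖ ^ 2) else μ * (c' * 1) with hψ₀
  have hΦ₁ : ∀ x ∈ (extChartAt (𝓡 4) p).source,
      ‖extChartAt (𝓡 4) p x - extChartAt (𝓡 4) p p‖ < r →
      ψ₀ x = prof (‖extChartAt (𝓡 4) p x - extChartAt (𝓡 4) p p‖ ^ 2) :=
    fun x hxs hxr ↦ if_pos ⟨hxs, hxr⟩
  refine ⟨ψ₀, ?_, ?_, ?_⟩
  · intro x
    by_cases hx : x ∈ (extChartAt (𝓡 4) p).symm ''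
        (Metric.closedBall (extChartAt (𝓡 4) p p) r ∩ {y | ‖y - extChartAt (𝓡 4) p p‖ ^ 2 ≤ S})
    · obtain ⟨hxs, hxr⟩ := HelperCapRealisationAux.mem_chartBall_of_mem_core hball hr hSr hx
      have hP : ContDiff ℝ ∞ fun z : EuclideanSpace ℝ (Fin 4) ↦
          prof (‖z - extChartAt (𝓡 4) p p‖ ^ 2) :=
        contDiff_const.mul (contDiff_const.mul
          (hn.comp ((contDiff_id.sub contDiff_const).norm_sq ℝ)))
      have hxs' : x ∈ (chartAt (EuclideanSpace ℝ (Fin 4)) p).source := by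
        rwa [← extChartAt_source (𝓡 4)]
      exact (hP.contDiffAt.comp_contMDiffAt (contMDiffAt_extChartAt' hxs')).congr_of_eventuallyEq
        (HelperCapRealisationAux.eventuallyEq_chart hΦ₁ hxs hxr)
    · refine (contMDiffAt_const (c := μ * (c' * 1))).congr_of_eventuallyEq ?_
      filter_upwards [(HelperCapRealisationAux.isClosed_core hball).isOpen_compl.mem_nhds hx]
        with z hz
      by_cases h : z ∈ (extChartAt (𝓡 4) p).source ∧
          ‖extChartAt (𝓡 4) p z - extChartAt (𝓡 4) p p‖ < r
      · rw [hΦ₁ z h.1 h.2, hprof]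
        simp only
        rw [hn1]
        refine not_lt.mp fun hlt ↦ hz ?_
        exact ⟨extChartAt (𝓡 4) p z, ⟨mem_closedBall_iff_norm.2 h.2.le, hlt.le⟩,
          (extChartAt (𝓡 4) p).left_inv h.1⟩
      · exact if_neg h
  · intro x
    by_cases h : x ∈ (extChartAt (𝓡 4) p).source ∧
        ‖extChartAt (𝓡 4) p x - extChartAt (𝓡 4) p p‖ < r
    · rw [hΦ₁ x h.1 h.2]
      exact mul_pos hμ (mul_pos hc' (hnpos _))
    · rw [show ψ₀ x = μ * (c' * 1) from if_neg h]
      positivity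
  · intro x hxs h1 h2
    rw [hΦ₁ x hxs (h2.trans_lt hρ₂r), hprof]
    simp only
    rw [hnann _ (pow_le_pow_left₀ hρ₁.le h1 2) (pow_le_pow_left₀ (norm_nonneg _) h2 2),
      HelperCapRealisationAux.sq_rpow_neg_half (norm_nonneg _)]

end AnnulusModelOnM

/-- **Aux helper `helper_annulusModelOnM_weight` of stub `helper_annulusModelOnM`** (line
`fat-conical-core-avr-logsobolev`, crux stmt-SmoothPoincare4-10871): for `p : M`,
`closedBall (φ p) r ⊆ φ.target` (`φ = extChartAt (𝓡 4) p`), `c' > 0`, `μ > 0` and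
`0 < ρ₁ < ρ₂ < r`, a smooth positive weight `ψ₀` on `M` equal to `μ c' ‖φ x − φ p‖^{−(c'+1)}` on
the closed chart annulus `ρ₁ ≤ ‖φ x − φ p‖ ≤ ρ₂` (`AnnulusModelOnM.exists_weight`). [folklore] -/
theorem helper_annulusModelOnM_weight :
    ∀ (M : Type) [TopologicalSpace M] [T2Space M] [ChartedSpace (EuclideanSpace ℝ (Fin 4)) M]
      [IsManifold (𝓡 4) ∞ M] (p : M) (r c' μ ρ₁ ρ₂ : ℝ),
      Metric.closedBall (extChartAt (𝓡 4) p p) r ⊆ (extChartAt (𝓡 4) p).target →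
      0 < r → 0 < c' → 0 < μ → 0 < ρ₁ → ρ₁ < ρ₂ → ρ₂ < r →
      ∃ ψ₀ : M → ℝ, ContMDiff (𝓡 4) 𝓘(ℝ, ℝ) ∞ ψ₀ ∧ (∀ x, 0 < ψ₀ x) ∧
        ∀ x, x ∈ (extChartAt (𝓡 4) p).source →
          ρ₁ ≤ ‖extChartAt (𝓡 4) p x - extChartAt (𝓡 4) p p‖ →
          ‖extChartAt (𝓡 4) p x - extChartAt (𝓡 4) p p‖ ≤ ρ₂ →
            ψ₀ x = μ * (c' * ‖extChartAt (𝓡 4) p x - extChartAt (𝓡 4) p p‖ ^ (-(c' + 1))) := by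
  intro M _ _ _ _ p r c' μ ρ₁ ρ₂ hball hr hc' hμ hρ₁ hρ₁₂ hρ₂r
  exact AnnulusModelOnM.exists_weight hball hr hc' hμ hρ₁ hρ₁₂ hρ₂r

end Summit.SmoothPoincare4.SmoothPoincare4.Theorems

end
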